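import Literature.NumberTheory.Kottwitz1992.Involutions
import Mathlib.LinearAlgebra.QuadraticForm.Basic
import Mathlib.LinearAlgebra.BilinearForm.Orthogonal
import Mathlib.LinearAlgebra.Projection
import HarnessLib

/-!
# [Kottwitz1992, Lemma 2.2 p. 379] The five characterisations of a positive involution are equivalent — DISCHARGED:
# `Kottwitz1992_2_2_tfae_holds`

Kernel-lane companion of the statement carpet ★ `Literature/NumberTheory/Kottwitz1992/Involutions.lean` (squad TK; ★ `InvolutionsHolds`
Lemma 2.3 (1), ★ `InvolutionsLemma21Holds` Lemma 2.1, ★ `InvolutionsLemma26Holds` Lemma 2.6 (1)): the named fact ★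
`Involutions.Kottwitz1992_2_2_tfae` — «The following are equivalent conditions on the involution `*`.  (1) Every `B`-module carries some
positive definite Hermitian form.  (2) For every faithful `B`-module `V` we have `tr(xx* ; V) > 0` for all nonzero `x ∈ B`.  (3)
`tr_{B/ℝ}(xx*) > 0` for all nonzero `x ∈ B`.  (4) There exists a `B`-module `V` such that `tr(xx* ; V) > 0` for all nonzero `x ∈ B`.  (5)
There exists a faithful positive definite Hermitian `B`-module.» — is PROVED here.  THEOREMS ONLY (no definition, no named fact, no `sorry`,
no instance, no notation); cell hodgecm-mathlib, seat B-typ02 (g31); net debt −1.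

R. E. Kottwitz, *Points on some Shimura varieties over finite fields*, J. Amer. Math. Soc. 5 (1992), Lemma 2.2 p. 379, proof p. 379 L43 –
p. 380 L7 (held `paper:doi-10-2307-2152772`, p0007 L33–L52, p0008 L5–L7).  THE PRINTED PROOF, followed implication by implication:
«(1) implies (2).  Let `V` be a faithful `B`-module.  By (1) there exists a positive definite Hermitian form on `V`.  Then `tr(xx* ; V)` is the
Hilbert–Schmidt norm of the endomorphism of `V` given by multiplication by `x`.  Since `V` is faithful, this norm is positive if `x` is
nonzero» (§3: the trace is computed in an orthogonal basis for the form, Mathlib `LinearMap.BilinForm.exists_orthogonal_basis`, as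
`∑ᵢ (x* eᵢ, x* eᵢ) / (eᵢ, eᵢ)`); «(2) implies (3) and (3) implies (4)» (`V = B`, §1); «(4) implies (5) […] Define a bilinear form `(x, y)₀` on
`B` by `(x, y)₀ = tr(xy* ; V)` and consider its symmetrization […] a positive definite Hermitian form on the faithful `B`-module `B`» (§2);
«(5) implies (1).  Let `V` be a faithful positive definite Hermitian `B`-module […] every irreducible `B`-module is isomorphic to one of these
direct summands and hence carries some positive definite Hermitian form.  This proves (1) because any `B`-module can be written as a direct
sum of irreducible `B`-modules» (§4: an irreducible module is a minimal left ideal, which acts non-trivially on the faithful module and so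
embeds in it; the direct sum is assembled by induction over the `B`-submodules of the given module, complements existing because `B` is
semisimple, the forms being pulled back along the projections).
HONEST LABEL: HC_CM is proved only modulo the 7 printed citations (2 remaining: hLiu418, h413) until rung 0 closes; this file adds no citation
debt (0 facts, 0 sorry) and discharges 1 named fact of ★ `Involutions`.

## References
* [Kottwitz1992] R. E. Kottwitz, Points on some Shimura varieties over finite fields, J. Amer. Math. Soc. 5 (1992) 373–444, Lemma 2.2 p. 379–380.
-/

namespace Literature.NumberTheory.Kottwitz1992.Involutions

open Literature.NumberTheory.Automorphic (leftMulTrace leftMulTrace_apply)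

universe u

variable {B : Type u} [Ring B] [Algebra ℝ B] (ι : B →ₗ[ℝ] B)

/-! ## §1 The module trace `tr(x ; V)`: cyclicity, linearity, and `tr(x ; B) = tr_{B/ℝ}(x)` -/

section ModuleTrace

variable {V : Type u} [AddCommGroup V] [Module ℝ V] [Module B V] [IsScalarTower ℝ B V]

omit ι in
/-- `v ↦ (x y) v` is the composite of `v ↦ y v` and `v ↦ x v`. [cite: Kottwitz1992, Lemma 2.2 (p. 379)] -/
private theorem toLinearMap_mul (x y : B) :
    DistribSMul.toLinearMap ℝ V (x * y) = DistribSMul.toLinearMap ℝ V x * DistribSMul.toLinearMap ℝ V y :=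
  LinearMap.ext fun v => by simp [Module.End.mul_apply, mul_smul]

omit ι in
/-- `tr(x y ; V) = tr(y x ; V)`. [cite: Kottwitz1992, Lemma 2.2 (p. 379)] -/
private theorem moduleTrace_mul_comm (x y : B) : moduleTrace B V (x * y) = moduleTrace B V (y * x) := by
  simp only [moduleTrace, toLinearMap_mul, LinearMap.trace_mul_comm]

omit ι in
/-- `tr(x + y ; V) = tr(x ; V) + tr(y ; V)`. [cite: Kottwitz1992, Lemma 2.2 (p. 379)] -/
private theorem moduleTrace_add (x y : B) : moduleTrace B V (x + y) = moduleTrace B V x + moduleTrace B V y := by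
  simp only [moduleTrace, ← map_add]
  congr 1
  exact LinearMap.ext fun v => by simp [add_smul]

omit ι in
/-- `tr(r x ; V) = r tr(x ; V)` for real `r`. [cite: Kottwitz1992, Lemma 2.2 (p. 379)] -/
private theorem moduleTrace_smul (r : ℝ) (x : B) : moduleTrace B V (r • x) = r * moduleTrace B V x := by
  simp only [moduleTrace, ← smul_eq_mul, ← map_smul]
  congr 1
  exact LinearMap.ext fun v => by simp [smul_assoc]

end ModuleTrace

omit ι in
/-- `tr(x ; B) = tr_{B/ℝ}(x)`: on the `B`-module `B`, multiplication by `x` is left multiplication. [cite: Kottwitz1992, Lemma 2.2 (p. 379)] -/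
private theorem moduleTrace_self (y : B) : moduleTrace B B y = leftMulTrace ℝ B y := by
  simp only [moduleTrace, leftMulTrace_apply]
  congr 1

/-! ## §2 (4) ⇒ (5): the symmetrised trace form on `B` -/

/-- **(4) ⇒ (5)** (p. 379 L47–L51): if `tr(xx* ; V) > 0` for all nonzero `x`, then «`(x, y) := (x, y)₀ + (y, x)₀`», `(x, y)₀ = tr(xy* ; V)`,
«is a positive definite Hermitian form on the faithful `B`-module `B`». [cite: Kottwitz1992, Lemma 2.2 (p. 379)] -/
private theorem exists_posDefHermitianForm_of_moduleTrace (hI : IsInvolution ℝ B ι)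
    {V : Type u} [AddCommGroup V] [Module ℝ V] [Module B V] [IsScalarTower ℝ B V]
    (h4 : ∀ x : B, x ≠ 0 → 0 < moduleTrace B V (x * ι x)) :
    ∃ Φ : LinearMap.BilinForm ℝ B, IsPosDefHermitianForm B B ι Φ := by
  refine ⟨LinearMap.mk₂ ℝ (fun x y => moduleTrace B V (x * ι y) + moduleTrace B V (y * ι x))
    (fun x x' y => ?_) (fun r x y => ?_) (fun x y y' => ?_) (fun r x y => ?_),
    ⟨fun x y => ?_, fun b x y => ?_⟩, fun x hx => ?_⟩
  · simp only [map_add, add_mul, mul_add, moduleTrace_add]; ring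
  · simp only [map_smul, smul_mul_assoc, mul_smul_comm, moduleTrace_smul, smul_eq_mul]; ring
  · simp only [map_add, add_mul, mul_add, moduleTrace_add]; ring
  · simp only [map_smul, smul_mul_assoc, mul_smul_comm, moduleTrace_smul, smul_eq_mul]; ring
  · simp only [LinearMap.mk₂_apply]; ring
  · simp only [LinearMap.mk₂_apply, smul_eq_mul, hI.map_mul, hI.apply_apply]
    have h1 : moduleTrace B V (b * x * ι y) = moduleTrace B V (x * (ι y * b)) := by
      rw [mul_assoc, moduleTrace_mul_comm, mul_assoc]
    have h2 : moduleTrace B V (y * (ι x * ι b)) = moduleTrace B V (ι b * y * ι x) := by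
      rw [← mul_assoc, moduleTrace_mul_comm, ← mul_assoc]
    rw [h1, h2]
  · simp only [LinearMap.mk₂_apply]
    have := h4 x hx
    linarith

/-! ## §3 (1) ⇒ (2): `tr(xx* ; V)` is a Hilbert–Schmidt norm -/

/-- **(1) ⇒ (2)** (p. 379 L43–L46): for a faithful `B`-module `V` with a positive definite Hermitian form, «`tr(xx* ; V)` is the
Hilbert–Schmidt norm of the endomorphism of `V` given by multiplication by `x`.  Since `V` is faithful, this norm is positive if `x` is
nonzero»: in an orthogonal basis `(eᵢ)` for the form, `tr(xx* ; V) = ∑ᵢ (eᵢ, x x* eᵢ)/(eᵢ, eᵢ) = ∑ᵢ (x* eᵢ, x* eᵢ)/(eᵢ, eᵢ) ≥ 0`, and `= 0`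
would force `x* eᵢ = 0` for all `i`, i.e. `x* = 0` by faithfulness. [cite: Kottwitz1992, Lemma 2.2 (p. 379)] -/
private theorem moduleTrace_mul_star_pos (hA : IsAlgebraWithInvolution B ι)
    {V : Type u} [AddCommGroup V] [Module ℝ V] [Module B V] [IsScalarTower ℝ B V] [Module.Finite B V] [FaithfulSMul B V]
    {φ : LinearMap.BilinForm ℝ V} (hφ : IsPosDefHermitianForm B V ι φ) (x : B) (hx : x ≠ 0) :
    0 < moduleTrace B V (x * ι x) := by
  haveI := hA.finiteDimensional
  haveI : Module.Finite ℝ V := Module.Finite.trans B V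
  haveI : Invertible (2 : ℝ) := invertibleOfNonzero two_ne_zero
  have hI : IsInvolution ℝ B ι := hA.isInvolution
  obtain ⟨b, hb⟩ := LinearMap.BilinForm.exists_orthogonal_basis (B := φ) ⟨fun v w => hφ.1.symm v w⟩
  have hd : ∀ i, 0 < φ (b i) (b i) := fun i => hφ.2 _ (b.ne_zero i)
  have hnn : ∀ u : V, 0 ≤ φ u u := fun u => by
    by_cases hu : u = 0
    · simp [hu]
    · exact (hφ.2 u hu).le
  -- coordinates in the orthogonal basis: `(eᵢ, v) = vᵢ (eᵢ, eᵢ)`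
  have hcoord : ∀ (v : V) (i), φ (b i) v = b.repr v i * φ (b i) (b i) := fun v i => by
    conv_lhs => rw [← b.sum_repr v]
    rw [map_sum]
    simp_rw [map_smul, smul_eq_mul]
    rw [Finset.sum_eq_single i (fun j _ hji => ?_) (fun h => (h (Finset.mem_univ i)).elim)]
    rw [LinearMap.isOrthoᵢ_def.1 hb i j (Ne.symm hji), mul_zero]
  -- the trace in the orthogonal basis
  have htr : moduleTrace B V (x * ι x) = ∑ i, φ (b i) ((x * ι x) • b i) / φ (b i) (b i) := by
    simp only [moduleTrace]
    rw [LinearMap.trace_eq_matrix_trace ℝ b]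
    simp only [Matrix.trace, Matrix.diag_apply, LinearMap.toMatrix_apply]
    refine Finset.sum_congr rfl fun i _ => ?_
    rw [eq_div_iff (hd i).ne', ← hcoord]
    rfl
  have hterm : ∀ i, φ (b i) ((x * ι x) • b i) = φ (ι x • b i) (ι x • b i) := fun i => by
    rw [mul_smul, hφ.1.symm, hφ.1.smul_left]
  -- faithfulness: some `x* eᵢ ≠ 0`
  have hex : ∃ i, ι x • b i ≠ 0 := by
    by_contra hall
    push Not at hall
    apply hx
    have hιx : ι x = 0 := by
      refine FaithfulSMul.eq_of_smul_eq_smul (α := V) fun v => ?_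
      rw [zero_smul, ← b.sum_repr v, Finset.smul_sum]
      exact Finset.sum_eq_zero fun i _ => by rw [smul_comm, hall i, smul_zero]
    rw [← hI.apply_apply x, hιx, map_zero]
  obtain ⟨i₀, hi₀⟩ := hex
  rw [htr]
  refine lt_of_lt_of_le (div_pos (by rw [hterm]; exact hφ.2 _ hi₀) (hd i₀))
    (Finset.single_le_sum (f := fun i => φ (b i) ((x * ι x) • b i) / φ (b i) (b i)) (fun i _ => ?_)
      (Finset.mem_univ i₀))
  rw [hterm]
  exact div_nonneg (hnn _) (hd i).le

/-! ## §4 (5) ⇒ (1): irreducibles embed in the faithful module; sum over a decomposition -/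

/-- **(5) ⇒ (1)** (p. 379 L52 – p. 380 L7): «Let `V` be a faithful positive definite Hermitian `B`-module […] every irreducible `B`-module is
isomorphic to one of these direct summands and hence carries some positive definite Hermitian form.  This proves (1) because any `B`-module
can be written as a direct sum of irreducible `B`-modules.»  Here: an irreducible `S` is a minimal left ideal (`B` semisimple), which acts
non-trivially on the faithful `V₀` and therefore embeds in it; the form of a general `V` is assembled by induction over its `B`-submodules
`N` (a Hermitian form on `V`, `≥ 0` everywhere and `> 0` on `N ∖ 0`), splitting off an irreducible `S ≤ N` with a complement `T`
(`B` semisimple) and adding the pull-back of the form of `V₀` along `V → S ↪ V₀`. [cite: Kottwitz1992, Lemma 2.2 (p. 379–380)] -/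
private theorem exists_posDefHermitianForm_of_faithful (hA : IsAlgebraWithInvolution B ι)
    {V₀ : Type u} [AddCommGroup V₀] [Module ℝ V₀] [Module B V₀] [IsScalarTower ℝ B V₀] [FaithfulSMul B V₀]
    {φ₀ : LinearMap.BilinForm ℝ V₀} (hφ₀ : IsPosDefHermitianForm B V₀ ι φ₀)
    (V : Type u) [AddCommGroup V] [Module ℝ V] [Module B V] [IsScalarTower ℝ B V] [Module.Finite B V] :
    ∃ φ : LinearMap.BilinForm ℝ V, IsPosDefHermitianForm B V ι φ := by
  haveI := hA.finiteDimensional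
  haveI := hA.isSemisimpleRing
  haveI : Module.Finite ℝ V := Module.Finite.trans B V
  -- (a) every irreducible submodule of `V` embeds `B`-linearly in the faithful module `V₀`
  have hemb : ∀ S : Submodule B V, IsSimpleModule B S → ∃ j : S →ₗ[B] V₀, Function.Injective j := by
    intro S hS
    haveI := hS
    haveI : Nontrivial S := IsSimpleModule.nontrivial B S
    obtain ⟨I, ⟨e⟩⟩ := IsSemisimpleRing.exists_linearEquiv_ideal_of_isSimpleModule B S
    haveI : IsSimpleModule B I := IsSimpleModule.congr e.symm
    obtain ⟨s, hs⟩ := exists_ne (0 : S)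
    have hi : (e s : B) ≠ 0 := fun h => hs (e.injective (by rw [map_zero]; exact Subtype.ext h))
    obtain ⟨v, hv⟩ : ∃ v : V₀, (e s : B) • v ≠ 0 := by
      by_contra hall
      push Not at hall
      exact hi (FaithfulSMul.eq_of_smul_eq_smul (α := V₀) fun v => by rw [hall v, zero_smul])
    let μ : I →ₗ[B] V₀ :=
      { toFun := fun a => (a : B) • v
        map_add' := fun a a' => by simp [add_smul]
        map_smul' := fun c a => by simp [mul_smul] }
    have hμ : Function.Injective μ := by
      rw [← LinearMap.ker_eq_bot]
      rcases IsSimpleOrder.eq_bot_or_eq_top (LinearMap.ker μ) with h | h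
      · exact h
      · exfalso
        apply hv
        have hmem : e s ∈ LinearMap.ker μ := by rw [h]; exact Submodule.mem_top
        simpa [μ] using hmem
    exact ⟨μ ∘ₗ e.toLinearMap, hμ.comp e.injective⟩
  -- (b) induction over the `B`-submodules `N` of `V`
  suffices h : ∀ (d : ℕ) (N : Submodule B V), Module.finrank ℝ (N.restrictScalars ℝ) = d →
      ∃ φ : LinearMap.BilinForm ℝ V, IsHermitianForm B V ι φ ∧ (∀ v, 0 ≤ φ v v) ∧ ∀ v ∈ N, v ≠ 0 → 0 < φ v v by
    obtain ⟨φ, hh, -, hpos⟩ := h _ ⊤ rfl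
    exact ⟨φ, hh, fun v hv => hpos v Submodule.mem_top hv⟩
  intro d
  induction d using Nat.strong_induction_on with
  | _ d ih => ?_
  intro N hd
  rcases IsAtomic.eq_bot_or_exists_atom_le N with hN | ⟨S, hS, hSN⟩
  · refine ⟨0, ⟨fun v w => by simp, fun b v w => by simp⟩, fun v => by simp, fun v hv hv0 => (hv0 ?_).elim⟩
    rw [hN] at hv
    exact (Submodule.mem_bot B).1 hv
  · haveI : IsSimpleModule B S := isSimpleModule_iff_isAtom.2 hS
    obtain ⟨T, hST⟩ := exists_isCompl S
    -- `N = S ⊕ (N ⊓ T)` (modular law) and the dimension drops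
    have hlt : Module.finrank ℝ ((N ⊓ T).restrictScalars ℝ) < d := by
      rw [← hd]
      refine Submodule.finrank_lt_finrank_of_lt (lt_of_le_of_ne (fun v hv => ?_) fun heq => hS.1 ?_)
      · exact (Submodule.mem_inf.1 (show v ∈ N ⊓ T from hv)).1
      · rw [eq_bot_iff]
        intro v hvS
        have hvNT : v ∈ (N ⊓ T).restrictScalars ℝ := by rw [heq]; exact hSN hvS
        have hvT : v ∈ T := (Submodule.mem_inf.1 (show v ∈ N ⊓ T from hvNT)).2
        have hv0 : v ∈ S ⊓ T := Submodule.mem_inf.2 ⟨hvS, hvT⟩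
        rwa [hST.inf_eq_bot] at hv0
    obtain ⟨φ', hh', hnn', hpos'⟩ := ih _ hlt (N ⊓ T) rfl
    -- the pull-back of `φ₀` along `V → S ↪ V₀`
    obtain ⟨j, hj⟩ := hemb S inferInstance
    let k : V →ₗ[ℝ] V₀ := ((j ∘ₗ Submodule.projectionOnto S T hST).restrictScalars ℝ)
    have hk : ∀ v, k v = j (Submodule.projectionOnto S T hST v) := fun v => rfl
    have hkB : ∀ (b : B) (v : V), k (b • v) = b • k v := fun b v => by rw [hk, hk, map_smul, map_smul]
    let ψ : LinearMap.BilinForm ℝ V := φ₀.comp k k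
    have hψ : ∀ v w, ψ v w = φ₀ (k v) (k w) := fun v w => rfl
    have hψnn : ∀ v, 0 ≤ ψ v v := fun v => by
      rw [hψ]
      by_cases h0 : k v = 0
      · simp [h0]
      · exact (hφ₀.2 _ h0).le
    refine ⟨φ' + ψ, ⟨fun v w => ?_, fun b v w => ?_⟩, fun v => ?_, fun v hv hv0 => ?_⟩
    · simp only [LinearMap.add_apply]
      rw [hh'.symm, hψ, hψ, hφ₀.1.symm]
    · simp only [LinearMap.add_apply]
      rw [hh'.smul_left, hψ, hψ, hkB, hkB, hφ₀.1.smul_left]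
    · simp only [LinearMap.add_apply]
      exact add_nonneg (hnn' v) (hψnn v)
    · simp only [LinearMap.add_apply]
      by_cases hπ : Submodule.projectionOnto S T hST v = 0
      · have hvT : v ∈ T := (Submodule.projectionOnto_apply_eq_zero_iff hST).1 hπ
        exact add_pos_of_pos_of_nonneg (hpos' v (Submodule.mem_inf.2 ⟨hv, hvT⟩) hv0) (hψnn v)
      · have hkv : k v ≠ 0 := fun h0 => hπ (hj (by rw [map_zero, ← hk]; exact h0))
        rw [hψ]
        exact add_pos_of_nonneg_of_pos (hnn' v) (hφ₀.2 _ hkv)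

/-! ## §5 The discharge -/

/-- **LEMMA 2.2, PROVED**: ★ `Kottwitz1992_2_2_tfae` holds — for a finite-dimensional semisimple `ℝ`-algebra `B` with involution `*` the
five conditions (1)–(5) are equivalent, by the printed cycle (1) ⇒ (2) (§3) ⇒ (3) (`V = B` is faithful, `tr(x ; B) = tr_{B/ℝ} x`) ⇒ (4)
(`V = B`) ⇒ (5) (§2) ⇒ (1) (§4). [cite: Kottwitz1992, Lemma 2.2 (p. 379–380)] -/
theorem Kottwitz1992_2_2_tfae_holds : Kottwitz1992_2_2_tfae B ι := by
  intro hA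
  have hI : IsInvolution ℝ B ι := hA.isInvolution
  tfae_have 1 → 2 := fun h1 V _ _ _ _ _ _ x hx => by
    obtain ⟨φ, hφ⟩ := h1 V
    exact moduleTrace_mul_star_pos ι hA hφ x hx
  tfae_have 2 → 3 := fun h2 x hx => by
    have h := h2 B x hx
    rwa [moduleTrace_self] at h
  tfae_have 3 → 4 := fun h3 =>
    ⟨B, inferInstance, inferInstance, inferInstance, inferInstance, inferInstance, fun x hx => by
      rw [moduleTrace_self]; exact h3 x hx⟩
  tfae_have 4 → 5 := fun ⟨V, _, _, _, _, _, h4⟩ => by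
    obtain ⟨Φ, hΦ⟩ := exists_posDefHermitianForm_of_moduleTrace ι hI h4
    exact ⟨B, inferInstance, inferInstance, inferInstance, inferInstance, inferInstance, inferInstance, Φ, hΦ⟩
  tfae_have 5 → 1 := fun ⟨V₀, _, _, _, _, _, _, φ₀, hφ₀⟩ V _ _ _ _ _ =>
    exists_posDefHermitianForm_of_faithful ι hA hφ₀ V
  tfae_finish

end Literature.NumberTheory.Kottwitz1992.Involutions
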